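import Summits.QuantumFields.QCD.Theorems.QuarksAsStableActionCriticalLineDiamagnetismEvenCycleChessboard

/-!
# The cyclic Hölder / chessboard inequality for alternating words of even length
(stub `stub_cyclicHolderEven` of line `registered`, crux `WilsonQuarkChessboard.FlatCellOptimal`,
item stmt-QuantumFields-9307)

For positive definite `T_i` and unitary `u_i` (`i ∈ ℤ/L`, `L = 2n` even, `L ≠ 0`),
`‖Tr (T_0 u_0 T_1 u_1 ⋯ T_{L-1} u_{L-1})‖^L ≤ ∏_i Re Tr T_i^L`.
This is the generalised Hölder inequality for Schatten norms with `2n` equal exponents, i.e. the tree theorem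
`evenCycleChessboard` (`‖Tr (B_0 ⋯ B_{2n-1})‖^{2n} ≤ ∏_j Re Tr ((B_j B_jᴴ)^n)`) at the letters
`B_j := T_j u_j`, for which `B_j B_jᴴ = T_j u_j u_jᴴ T_jᴴ = T_j²` and hence `(B_j B_jᴴ)^n = T_j^L`.
The odd-length analogue is `stub_cyclicHolder` (crux stmt-QuantumFields-9736).
References: J. Fröhlich, R. Israel, E. H. Lieb, B. Simon, Commun. Math. Phys. 62 (1978) 1, Thm. 4.1;
B. Simon, *Trace ideals and their applications*, Thm. 2.8.  Pure theorem file (no definitions).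
-/

namespace Summit.QuantumFields.QCD.Cruxes.FlatCellOptimal.Diamag

open Matrix
open scoped ComplexOrder
open Summit.QuantumFields.QCD.Cruxes.CriticalLineDiamagnetism.ChessboardCellGain
open Summit.QuantumFields.QCD.Cruxes.WilsonQuarkStability.FreeTangentLandauChessboard.ChessboardOfReflection

namespace CyclicHolderEven

/-- `evenCycleChessboard` with the index type `Fin m` for any `m = 2 n` (transport of the index bound). -/
theorem evenCycleChessboard_of_eq {k : Type} [Fintype k] [DecidableEq k] (n : ℕ) (hn : 0 < n) :
    ∀ (m : ℕ), m = 2 * n → ∀ (B : Fin m → Matrix k k ℂ),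
      ‖(List.ofFn B).prod.trace‖ ^ m ≤ ∏ j : Fin m, ((B j * (B j)ᴴ) ^ n).trace.re := by
  rintro m rfl B
  exact evenCycleChessboard n hn B

/-- For a Hermitian (here: positive definite) `T` and a unitary `u`: `(T u) (T u)ᴴ = T u uᴴ Tᴴ = T T`. -/
theorem mul_unitary_mul_conjTranspose {k : Type} [Fintype k] [DecidableEq k] {T u : Matrix k k ℂ}
    (hT : T.PosDef) (hu : u ∈ Matrix.unitaryGroup k ℂ) : T * u * (T * u)ᴴ = T * T := by
  rw [conjTranspose_mul, Matrix.mul_assoc, ← Matrix.mul_assoc u, ← star_eq_conjTranspose u,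
    Matrix.mem_unitaryGroup_iff.mp hu, Matrix.one_mul, hT.isHermitian.eq]

/-- A list given by a function on `Fin m` through the coercion to `ℕ` is a map over `List.range m`. -/
theorem ofFn_coe_eq_map_range {α : Type} {m : ℕ} (f : ℕ → α) :
    (List.ofFn fun j : Fin m => f (j : ℕ)) = (List.range m).map f := by
  rw [List.ofFn_eq_map, ← List.map_coe_finRange_eq_range, List.map_map]
  rfl

end CyclicHolderEven

open CyclicHolderEven in
/-- **Stub `stub_cyclicHolderEven`** (line `registered`, crux stmt-QuantumFields-9307): the cyclic Hölder /
chessboard inequality `‖Tr ∏_{i<L} T_i u_i‖^L ≤ ∏_i Re Tr T_i^L` for positive definite `T_i`, unitary `u_i`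
and even `L ≠ 0` — `evenCycleChessboard` at `B_j := T_j u_j`, `B_j B_jᴴ = T_j²` (module docstring). -/
theorem stub_cyclicHolderEven :
    ∀ (L : ℕ) [NeZero L], Even L → ∀ {k : Type} [Fintype k] [DecidableEq k] (T u : ZMod L → Matrix k k ℂ),
      (∀ i, (T i).PosDef) → (∀ i, u i ∈ Matrix.unitaryGroup k ℂ) →
      ‖((List.range L).map fun i : ℕ => T (i : ZMod L) * u (i : ZMod L)).prod.trace‖ ^ L ≤
        ∏ i : ZMod L, ((T i) ^ L).trace.re := by
  intro L _ hL k _ _ T u hT hu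
  obtain ⟨n, hn⟩ := hL
  have hL2 : L = 2 * n := by omega
  have hn0 : 0 < n := by have := NeZero.ne L; omega
  -- the two sides of `evenCycleChessboard` at `B_j := T_j u_j`, `j : Fin L`
  have hlist : (List.ofFn fun j : Fin L => T ((j : ℕ) : ZMod L) * u ((j : ℕ) : ZMod L)) =
      (List.range L).map fun i : ℕ => T (i : ZMod L) * u (i : ZMod L) :=
    ofFn_coe_eq_map_range fun i : ℕ => T (i : ZMod L) * u (i : ZMod L)
  have hprod : ∏ j : Fin L, ((T ((j : ℕ) : ZMod L) * u ((j : ℕ) : ZMod L) *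
      (T ((j : ℕ) : ZMod L) * u ((j : ℕ) : ZMod L))ᴴ) ^ n).trace.re = ∏ i : ZMod L, ((T i) ^ L).trace.re := by
    rw [prod_univ_eq_prod_range (fun i : ZMod L => ((T i) ^ L).trace.re),
      ← Fin.prod_univ_eq_prod_range (fun q : ℕ => ((T (q : ZMod L)) ^ L).trace.re) L]
    refine Finset.prod_congr rfl fun j _ => ?_
    rw [mul_unitary_mul_conjTranspose (hT _) (hu _), ← sq, ← pow_mul, ← hL2]
  rw [← hlist, ← hprod]
  exact evenCycleChessboard_of_eq n hn0 L hL2 _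

end Summit.QuantumFields.QCD.Cruxes.FlatCellOptimal.Diamag
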